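import Summits.ResolutionOfSingularities.ResolutionOfSingularities.Theorems.HomologicalConductorNoZenoSandwichedGermEntry
import HarnessLib

/-!
# Route `HomologicalConductor`, crux `NoZenoR` (stmt-ResolutionOfSingularities-19943; aside twin `NoZeno` 16483):
# habitat entry from the UNION of the thread germs (UE) — in particular FROM EXHAUSTION — and a local
# uniformization of the dominating valuation ring

`[OURS · L W4.4]` Cell res-hironaka, crux chain W4.4; sequel of `…NoZenoSandwichedGermEntry` (p533054), offered to
planner res-L0-w44-plan-1 as the typed mechanism of the exhaustive branch of the (V26) entry stub `stub_HabExSw₀`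
(«every infinite singular prime thread passes through ONE sandwiched germ past the escape stage»).  Nothing here is a
statement of the manuscript under review (Hironaka 2017); AI-written, weaker than expert review.

* `exists_le_locPrime_of_essFiniteType` — an essentially-of-finite-type `k`-subalgebra of `K` contained in and
  dominated by the union `W` of the thread germs lies in ONE germ `D_N`, dominated (finitely many essential
  generators; unit inverses by domination).
* `not_essFiniteType_of_dominated_union` — past a non-regular germ, `W = ⋃ D_m` is NOT essentially of finite type over `k`
  (else `W = D_N` would be a Noetherian valuation ring, hence regular): the thread coarsening is never divisorial.
* `exists_isSandwichedGerm_of_union` — **(UE) UNION ENTRY**: if a valuation ring `W` contains, dominates and is the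
  union of the thread germs and dominates such an `R`, some germ past any given stage is sandwiched (no exhaustion,
  no `O ≤ W`; the branch «`D_∞` is a valuation ring» of the thread dichotomy).
* `exists_isSandwichedGerm_of_exhausts` — **HabEx₀ for the sandwiched habitat from two named inputs**: if the stages
  exhaust `O` (`Parasite.Exhausts O A`) and the thread coarsening `W ⊇ O` (the valuation ring `⋃_m D_m = O_𝔔` of
  `exists_coarsening_of_exhausts`, which dominates every thread germ) admits a LOCAL UNIFORMIZATION WITH
  TWO-DIMENSIONAL CENTRE — a `k`-subalgebra `R` of `K`, regular local of Krull dimension `2`, essentially of finite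
  type over `k`, with `Frac R = K`, DOMINATED by `W` — then for every `mₑ` some thread germ `D_(n+1)`, `n ≥ mₑ`, is
  sandwiched (`IsSandwichedGerm`).  Proof: `R` is a localisation of a finitely generated `k`-algebra `k[x₁,…,x_r] ⊆ R`;
  each `xᵢ` lies in `W = ⋃ D_m`, hence all lie in one `D_N` (`N > mₑ`, the germs increase); a unit `t` of `R` has
  `t⁻¹ ∈ W`, so `t⁻¹ ∈ D_N` by domination, whence `R ⊆ D_N`, dominated; conclude by
  `isSandwichedGerm_locPrime_of_dominated` (Lipman (2.1) HAB-step, p. 202 L36–40, in thread form).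
  The printed local-uniformization input over `k₁ = k(w)` (CJS in dimension two) is NOT typed here; the hypothesis
  `hLU` states exactly what is consumed.

References: J. Lipman, Publ. Math. IHÉS 36 (1969), Thm. (2.1) [`Lipman1969`] (precedent; nothing typed from it).
-/

-- single-problem summit: the doubled namespace component `ResolutionOfSingularities` is forced
set_option linter.dupNamespace false

noncomputable section

open IsLocalRing
open Literature.AlgebraicGeometry.Resolution

namespace Summit.ResolutionOfSingularities.ResolutionOfSingularities.Theorems.NoZeno.Sandwiched

open Summit.ResolutionOfSingularities.ResolutionOfSingularities.Theses.HomologicalConductor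
open Summit.ResolutionOfSingularities.ResolutionOfSingularities.Theorems.NoZeno.Birth
open Summit.ResolutionOfSingularities.ResolutionOfSingularities.Theorems.NoZeno.SandwichCluster.Parasite
  (locPrime mem_locPrime_iff mem_locPrime_of_mem Exhausts ne_zero_of_not_mem_ideal)

variable {k K : Type} [Field k] [Field K] [Algebra k K]

section
variable (O : ValuationSubring K) (A : Subalgebra k K)
  (hk : ∀ c : k, algebraMap k K c ∈ O) (hA : A.FG) (hfr : IsFractionRing ↥A K) (hAO : A.toSubring ≤ O.toSubring)
  (P : ∀ m : ℕ, Ideal ↥(tower O A m)) (hP : ∀ m, (P m).IsPrime)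
  (hcompat : ∀ (m : ℕ) (x : K) (hx : x ∈ tower O A m) (hx' : x ∈ tower O A (m + 1)),
    (⟨x, hx'⟩ : ↥(tower O A (m + 1))) ∈ P (m + 1) ↔ (⟨x, hx⟩ : ↥(tower O A m)) ∈ P m)

/-! Indexing: as in the planner's `Beta2Descent.germ O A P hP n = locPrime (tower O A (n+1)) (P (n+1)) (hP (n+1))` — the
NORMAL germs `D_(n+1)`, `n : ℕ`; all hypotheses «every germ» below quantify over this indexing. -/

include hcompat in
/-- **An essentially-of-finite-type `k`-subalgebra of the union of the thread germs lies in ONE germ, dominated.**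
Let `W` contain and dominate every thread germ `D_(n+1)` and be their union.  If `R ⊆ K` is a `k`-subalgebra essentially of
finite type over `k`, contained in and DOMINATED by `W`, then for every `m₀` there is `N ≥ m₀` with `R ⊆ D_(N+1)` and
`D_(N+1)` dominating `R` (the inclusion reflects units): the finitely many essential generators of `R` lie in one germ (the
germs increase), and a unit `t` of `R` has `t⁻¹ ∈ W`, hence `t⁻¹ ∈ D_(N+1)` by domination. [this work] -/
theorem exists_le_locPrime_of_essFiniteType (W : ValuationSubring K)
    (hdom : ∀ n : ℕ, SubringDominates (locPrime (tower O A (n + 1)) (P (n + 1)) (hP (n + 1))) W.toSubring)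
    (hunion : ∀ x : K, x ∈ W → ∃ n : ℕ, x ∈ locPrime (tower O A (n + 1)) (P (n + 1)) (hP (n + 1)))
    (R : Subalgebra k K) [Algebra.EssFiniteType k ↥R] (hRW : SubringDominates R.toSubring W.toSubring) (m₀ : ℕ) :
    ∃ (N : ℕ) (hRD : R.toSubring ≤ locPrime (tower O A (N + 1)) (P (N + 1)) (hP (N + 1))), m₀ ≤ N ∧
      ∀ r : ↥R, IsUnit (Subring.inclusion hRD r) → IsUnit r := by
  classical
  -- every element of `R ⊆ W = ⋃ D_(n+1)` lies in some thread germ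
  have hRm : ∀ x : ↥R, ∃ n : ℕ, (x : K) ∈ locPrime (tower O A (n + 1)) (P (n + 1)) (hP (n + 1)) :=
    fun x => hunion x (hRW.1 x.2)
  choose mx hmx using hRm
  set σ := Algebra.EssFiniteType.finset k ↥R with hσ
  set N : ℕ := max (σ.sup mx) m₀ with hN
  set D := locPrime (tower O A (N + 1)) (P (N + 1)) (hP (N + 1)) with hD
  have hgenD : ∀ x ∈ σ, ((x : ↥R) : K) ∈ D := by
    intro x hx
    have hle : mx x + 1 ≤ N + 1 :=
      Nat.succ_le_succ ((Finset.le_sup hx).trans (le_max_left _ _))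
    exact locPrime_tower_subset_of_le O A P hP hcompat hle (hmx x)
  -- the preimage of `D` in `R` is a `k`-subalgebra containing the generators
  let S : Subalgebra k ↥R :=
    { carrier := {r | ((r : ↥R) : K) ∈ D}
      mul_mem' := fun {a b} ha hb => by
        change ((a * b : ↥R) : K) ∈ D
        rw [Subalgebra.coe_mul]; exact D.mul_mem ha hb
      one_mem' := by change ((1 : ↥R) : K) ∈ D; rw [Subalgebra.coe_one]; exact D.one_mem
      add_mem' := fun {a b} ha hb => by
        change ((a + b : ↥R) : K) ∈ D
        rw [Subalgebra.coe_add]; exact D.add_mem ha hb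
      zero_mem' := by change ((0 : ↥R) : K) ∈ D; rw [Subalgebra.coe_zero]; exact D.zero_mem
      algebraMap_mem' := fun c => by
        change ((algebraMap k ↥R c : ↥R) : K) ∈ D
        rw [Subalgebra.coe_algebraMap]
        exact mem_locPrime_of_mem _ _ _ ((tower O A (N + 1)).algebraMap_mem c) }
  have hadj : Algebra.EssFiniteType.subalgebra k ↥R ≤ S :=
    Algebra.adjoin_le fun x hx => hgenD x (by simpa [hσ] using hx)
  -- every element of `R` lies in `D`: `r = b · t⁻¹`, `b, t` in the finite-type model, `t` a unit of `R`
  have hRD' : ∀ r : ↥R, (r : K) ∈ D := by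
    intro r
    obtain ⟨⟨b, t⟩, hbt⟩ := IsLocalization.surj (Algebra.EssFiniteType.submonoid k ↥R) r
    have htu : IsUnit ((t : ↥(Algebra.EssFiniteType.subalgebra k ↥R)) : ↥R) := by
      have h : (t : ↥(Algebra.EssFiniteType.subalgebra k ↥R)) ∈
          (IsUnit.submonoid ↥R).comap (algebraMap ↥(Algebra.EssFiniteType.subalgebra k ↥R) ↥R) := t.2
      exact h
    have hbD : (((b : ↥(Algebra.EssFiniteType.subalgebra k ↥R)) : ↥R) : K) ∈ D := hadj b.2
    have htD : ((((t : ↥(Algebra.EssFiniteType.subalgebra k ↥R)) : ↥R)) : K) ∈ D := hadj t.1.2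
    obtain ⟨ht0, htinvR⟩ := (isUnit_subring_iff_inv_mem (R := R.toSubring)
      ((t : ↥(Algebra.EssFiniteType.subalgebra k ↥R)) : ↥R)).mp htu
    have htinvD : ((((t : ↥(Algebra.EssFiniteType.subalgebra k ↥R)) : ↥R)) : K)⁻¹ ∈ D :=
      (hdom N).2 _ htD (hRW.1 htinvR)
    have hbt' : (r : K) * (((t : ↥(Algebra.EssFiniteType.subalgebra k ↥R)) : ↥R) : K) =
        (((b : ↥(Algebra.EssFiniteType.subalgebra k ↥R)) : ↥R) : K) := by
      have := congrArg (fun z : ↥R => (z : K)) hbt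
      simpa using this
    rw [← eq_mul_inv_iff_mul_eq₀ ht0] at hbt'
    rw [hbt']
    exact D.mul_mem hbD htinvD
  have hRD : R.toSubring ≤ D := fun x hx => hRD' ⟨x, hx⟩
  refine ⟨N, hRD, le_max_right _ _, fun r hr => ?_⟩
  obtain ⟨hr0, hrinvD⟩ := (isUnit_subring_iff_inv_mem _).mp hr
  have hrinvW : (r : K)⁻¹ ∈ W.toSubring := (hdom N).1 hrinvD
  have hrinvR : (r : K)⁻¹ ∈ R.toSubring := hRW.2 (r : K) r.2 hrinvW
  exact (isUnit_subring_iff_inv_mem (R := R.toSubring) r).mpr ⟨hr0, hrinvR⟩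

include hcompat in
/-- **The union of the thread germs is NOT essentially of finite type past a singular germ.**  With `W` as above (contains,
dominates and is the union of the germs `D_(n+1)`), if some tail of the thread consists of NON-regular germs (T-GERM, past the
escape stage), then `W` is not the subring of any `k`-subalgebra of `K` essentially of finite type over `k`: otherwise
`W ⊆ D_(N+1) = W` for a late `N` (`exists_le_locPrime_of_essFiniteType`), and a Noetherian valuation ring is a discrete valuation
ring or a field, hence regular.  In particular a thread whose union ring is a valuation ring never has a PRIME DIVISOR as
union ring (divisorial valuation rings are essentially of finite type). [this work] -/
theorem not_essFiniteType_of_dominated_union (W : ValuationSubring K)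
    (hdom : ∀ n : ℕ, SubringDominates (locPrime (tower O A (n + 1)) (P (n + 1)) (hP (n + 1))) W.toSubring)
    (hunion : ∀ x : K, x ∈ W → ∃ n : ℕ, x ∈ locPrime (tower O A (n + 1)) (P (n + 1)) (hP (n + 1)))
    (m₀ : ℕ) (hsing : ∀ n : ℕ, m₀ ≤ n → ¬ IsRegularLocalRing ↥(locPrime (tower O A (n + 1)) (P (n + 1)) (hP (n + 1))))
    (B : Subalgebra k K) (hB : B.toSubring = W.toSubring) [Algebra.EssFiniteType k ↥B] : False := by
  have hBW : SubringDominates B.toSubring W.toSubring := ⟨hB.le, fun x hx _ => by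
    have : x⁻¹ ∈ W.toSubring := ‹_›
    rwa [← hB] at this⟩
  obtain ⟨N, hBD, hN, -⟩ :=
    exists_le_locPrime_of_essFiniteType O A P hP hcompat W hdom hunion B hBW m₀
  set D := locPrime (tower O A (N + 1)) (P (N + 1)) (hP (N + 1)) with hD
  have hDW : D = W.toSubring := le_antisymm (hdom N).1 (hB ▸ hBD)
  -- `W` is a Noetherian valuation ring, hence regular
  haveI : IsNoetherianRing ↥B := Algebra.EssFiniteType.isNoetherianRing k ↥B
  let eBW : ↥B.toSubring ≃+* ↥W.toSubring := RingEquiv.subringCongr hB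
  haveI : IsNoetherianRing ↥W := isNoetherianRing_of_ringEquiv ↥B eBW
  haveI : IsPrincipalIdealRing ↥W := IsPrincipalIdealRing.of_isNoetherianRing_of_isBezout
  have hWreg : IsRegularLocalRing ↥W := inferInstance
  let eWD : ↥W.toSubring ≃+* ↥D := RingEquiv.subringCongr hDW.symm
  exact hsing N hN (IsRegularLocalRing.of_ringEquiv eWD)

include hk hA hfr hAO hcompat in
/-- **HABITAT ENTRY, UNION FORM (UE)** — the planner's `Sig.UnionEntry` (r3.3 `Beta2Descent-r3_3.lean` §8) with the same
binders.  Let `W` be a valuation ring of `K` that contains and DOMINATES every thread germ `D_(n+1)` and is their UNION (the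
branch «`D_∞ := ⋃ D_m` is a valuation ring» of the thread dichotomy (TD); for an exhaustive thread `W = O_𝔔`,
`exists_coarsening_of_exhausts`).  If `W` dominates a regular local `k`-subalgebra `R ⊆ K` of Krull dimension `2`, essentially
of finite type over `k`, with `Frac R = K` (a local uniformization of `W` with two-dimensional centre, (LU₂W)), then for
every `mₑ` some thread germ `D_(n+1)`, `mₑ ≤ n`, is SANDWICHED (`exists_le_locPrime_of_essFiniteType` +
`isSandwichedGerm_locPrime_of_dominated`).  No exhaustion and no `O ≤ W` is used. [this work] -/
theorem exists_isSandwichedGerm_of_union (W : ValuationSubring K)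
    (hdom : ∀ n : ℕ, SubringDominates (locPrime (tower O A (n + 1)) (P (n + 1)) (hP (n + 1))) W.toSubring)
    (hunion : ∀ x : K, x ∈ W → ∃ n : ℕ, x ∈ locPrime (tower O A (n + 1)) (P (n + 1)) (hP (n + 1)))
    (hLU : ∃ R : Subalgebra k K, IsRegularLocalRing ↥R ∧ ringKrullDim ↥R = 2 ∧ IsFractionRing ↥R K ∧
      Algebra.EssFiniteType k ↥R ∧ SubringDominates R.toSubring W.toSubring)
    (mₑ : ℕ) :
    ∃ n : ℕ, mₑ ≤ n ∧ IsSandwichedGerm ↥(locPrime (tower O A (n + 1)) (P (n + 1)) (hP (n + 1))) := by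
  obtain ⟨R, hreg, hdim, hRfr, hET, hRW⟩ := hLU
  haveI := hreg
  haveI := hET
  obtain ⟨n, hRD, hn, hdomR⟩ :=
    exists_le_locPrime_of_essFiniteType O A P hP hcompat W hdom hunion R hRW mₑ
  exact ⟨n, hn,
    isSandwichedGerm_locPrime_of_dominated O A hk hA hfr hAO (n + 1) (P (n + 1)) (hP (n + 1)) R hdim hRfr hRD hdomR⟩

include hk hA hfr hAO hcompat in
/-- **HABITAT ENTRY FROM EXHAUSTION + LU₂.**  If the stages exhaust `O`, the coarsening `W = O_𝔔 ⊇ O`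
(`exists_coarsening_of_exhausts`) contains, dominates and is the union of all thread germs; past a tail of NON-regular germs
(T-GERM) it is not essentially of finite type over `k` (`not_essFiniteType_of_dominated_union`).  So if every such `W` —
containing `O`, dominating and exhausted by the germs, not essentially of finite type — dominates a regular two-dimensional
essentially-finite-type `k`-subalgebra `R` with `Frac R = K` (res-L0-w44-stub-1's (LU₂W), interface of 13:32:31Z), then some
germ past any given stage is sandwiched (`exists_isSandwichedGerm_of_union`). [this work] -/
theorem exists_isSandwichedGerm_of_exhausts (hexh : Exhausts O A)
    (m₀ : ℕ) (hsing : ∀ n : ℕ, m₀ ≤ n → ¬ IsRegularLocalRing ↥(locPrime (tower O A (n + 1)) (P (n + 1)) (hP (n + 1))))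
    (hLU : ∀ W : ValuationSubring K, O ≤ W →
      (∀ n : ℕ, SubringDominates (locPrime (tower O A (n + 1)) (P (n + 1)) (hP (n + 1))) W.toSubring) →
      (∀ x : K, x ∈ W → ∃ n : ℕ, x ∈ locPrime (tower O A (n + 1)) (P (n + 1)) (hP (n + 1))) →
      (¬ ∃ B : Subalgebra k K, B.toSubring = W.toSubring ∧ Algebra.EssFiniteType k ↥B) →
      ∃ R : Subalgebra k K, IsRegularLocalRing ↥R ∧ ringKrullDim ↥R = 2 ∧ IsFractionRing ↥R K ∧
        Algebra.EssFiniteType k ↥R ∧ SubringDominates R.toSubring W.toSubring)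
    (mₑ : ℕ) :
    ∃ n : ℕ, mₑ ≤ n ∧ IsSandwichedGerm ↥(locPrime (tower O A (n + 1)) (P (n + 1)) (hP (n + 1))) := by
  obtain ⟨W, hOW, hdom', hunion'⟩ := exists_coarsening_of_exhausts O A P hP hcompat hk hAO hexh
  have hdom : ∀ n : ℕ, SubringDominates (locPrime (tower O A (n + 1)) (P (n + 1)) (hP (n + 1))) W.toSubring :=
    fun n => hdom' (n + 1)
  -- every element of `W` lies in a germ of positive index (the germs increase)
  have hunion : ∀ x : K, x ∈ W → ∃ n : ℕ, x ∈ locPrime (tower O A (n + 1)) (P (n + 1)) (hP (n + 1)) := by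
    intro x hx
    obtain ⟨m, hm⟩ := hunion' x hx
    exact ⟨m, locPrime_tower_subset_of_le O A P hP hcompat (Nat.le_succ m) hm⟩
  have hnot : ¬ ∃ B : Subalgebra k K, B.toSubring = W.toSubring ∧ Algebra.EssFiniteType k ↥B := by
    rintro ⟨B, hB, hBft⟩
    exact not_essFiniteType_of_dominated_union O A P hP hcompat W hdom hunion m₀ hsing B hB
  exact exists_isSandwichedGerm_of_union O A hk hA hfr hAO P hP hcompat W hdom hunion (hLU W hOW hdom hunion hnot) mₑ

end

end Summit.ResolutionOfSingularities.ResolutionOfSingularities.Theorems.NoZeno.Sandwiched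

end
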